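import Literature.Algebra.Polynomial.CrossSequences
import Mathlib.Tactic
import HarnessLib

/-!
# Steffensen sequences and the structure of cross-sequences (Rota–Kahaner–Odlyzko §8, Propositions 1–5)

G.-C. Rota, D. Kahaner, A. Odlyzko, *Finite operator calculus* (1973), §8 "Cross-sequences",
pp. 713–716 (the sequel of Theorem 8; `p_n^{[λ]} = P^{−λ} p_n` a cross-sequence, `p_n` basic for
the delta operator `Q`, `P^{−λ}` a one-parameter group, written `exp (−λF)` with the generator `F`):

> **Proposition 1.** The coefficients `c(n,k,λ)` of a cross-sequence,
> `P^{−λ} p_n (x) = p_n^{[λ]} (x) = Σ_k c(n,k,λ) xᵏ`, are polynomials of degree at most `n` in the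
> variable `λ`.
> A *Steffensen sequence* `s_n^{[λ]} (x)` relative to a cross-sequence `p_n^{[λ]}` is a sequence
> satisfying the identities `s_n^{[λ+μ]} (x + y) = Σ_k C(n,k) s_k^{[λ]} (x) p_{n−k}^{[μ]} (y)`.
> **Proposition 2.** The following conditions are equivalent: (a) `s_n^{[λ]}` is a Steffensen
> sequence; (b) there exists a delta operator `Q` and a one-parameter group of shift-invariant
> operators `P^{−λ}` such that `Q s_n^{[λ]} = n s_{n−1}^{[λ]}`, `P^{−λ} s_n^{[0]} = s_n^{[λ]}`; (c) there
> exists a cross-sequence `p_n^{[λ]}` and an invertible shift-invariant operator `T` such that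
> `s_n^{[λ]} = T⁻¹ p_n^{[λ]}`. The proof follows well trodden paths and is omitted.
> **Proposition 3.** Let `s_n^{[λ]}` be a Steffensen sequence relative to the shift-invariant operator
> `T = Q′` [`s_n^{[λ]} = (Q′)⁻¹ p_n^{[λ]}`], with `s_0^{[λ]} = 1` for all `λ`. Then the sequence
> `x s_{n−1}^{[n]} (x)` is a sequence of binomial type. *Proof.* Use Theorem 4: … comparing with (6)
> of the corollary to Theorem 4, we find that the right side is basic with delta operator `R = PQ`.
> **Proposition 4.** Suppose that `I − P = Q`, where `Q` is the delta operator of `p_n (x)`. Then …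
> `p_n^{[λ+1]} (x) − p_n^{[λ]} (x) = P^{−λ−1} (I − P) p_n (x) = n P^{−λ−1} p_{n−1} (x) = n p_{n−1}^{[λ+1]} (x)`
> [so that `p_n^{[x−n]} (a)` is, for fixed `a`, a Sheffer sequence relative to `Δ = E − I`].
> **Proposition 5.** For Appell cross sequences, namely of the form `p_n^{[λ]} (x) = P^{−λ} xⁿ`, we
> have the umbral composition `p^{[λ]} (p^{[μ]} (x)) = p^{[λ+μ]} (x)`. *Proof.* Apply Corollary 2 to
> Theorem 7.

Conventions as in `CrossSequences.lean`: a one-parameter group is `P : K → (K[X] →ₗ[K] K[X])` with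
`IsOneParameterGroup P` (`P a` is RKO's `P^{−a}`, so `P^{1} = P (−1)` and `R = PQ = P (−1) ∘ Q`), the
generator form is `expOp F a = e^{aF} (D)`. Proposition 1 (polynomiality in `λ`) is stated for the
generator form `e^{λF}`, where it holds, through the finite expansion
`e^{λF} f = Σ_{k ≤ deg f} λᵏ F^k f / k!` (`expOp_apply_eq_sum`); Propositions 2, 4 (the displayed
difference equation), 5 for abstract one-parameter groups; Proposition 3 for `Q = D φ(D)` and an
exponential group, with the printed example of the Abel polynomials (`Q = D`, `F = t`:
`x (x + n)^{n−1}`). The closing clause of Proposition 4 and Proposition 6 (a) (generators add) are NOT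
typed here.

Definitions (with bodies): `IsSteffensenSequence p s`.
Main statements: `expOp_apply_eq_sum`, `exists_polynomial_coeff_expOp` / `exists_polynomial_eval_expOp`
(Proposition 1), `IsSteffensenSequence.of_map` ((c) ⇒ (a)), `IsSteffensenSequence.isShefferSequence`,
`IsSteffensenSequence.exists_isShiftInvariant` ((a) ⇒ (c)), `IsSteffensenSequence.exists_delta_group`
((a) ⇒ (b)), `exists_isSteffensenSequence_of_delta_group` ((b) ⇒ (a), (c)),
`isBasicSequence_X_mul_steffensen` (Proposition 3) with `abelPolynomial_neg_one_eq` (the Abel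
instance), `IsOneParameterGroup.apply_add_one_sub` (Proposition 4), `umbralComp_oneParameterGroup_X_pow`
(Proposition 5).

## References
* [RotaKahanerOdlyzko1973] G.-C. Rota, D. Kahaner, A. Odlyzko, *On the foundations of
  combinatorial theory VIII. Finite operator calculus*, J. Math. Anal. Appl. 42 (1973) 684–760,
  §8 Propositions 1–5, pp. 713–716.
-/

noncomputable section

open Polynomial Finset

namespace Literature.Algebra.Polynomial

variable {K : Type*} [Field K]

/-- A **Steffensen sequence** `s_n^{[λ]}` relative to a cross-sequence `p_n^{[λ]}` (`s a n` is
`s_n^{[a]}`): for fixed `λ` a polynomial sequence (`deg s_n^{[λ]} = n`), satisfying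
`s_n^{[λ+μ]} (x + y) = Σ_{k=0}^{n} C(n,k) s_k^{[λ]} (x) p_{n−k}^{[μ]} (y)` for all `n, λ, μ, x, y`.
[cite: RotaKahanerOdlyzko1973, §8 (definition of a Steffensen sequence), p. 714] -/
structure IsSteffensenSequence (p s : K → ℕ → K[X]) : Prop where
  degree_eq : ∀ (a : K) (n : ℕ), (s a n).degree = n
  eval_add : ∀ (a b : K) (n : ℕ) (x y : K), (s (a + b) n).eval (x + y) =
    ∑ k ∈ range (n + 1), (n.choose k : K) * (s a k).eval x * (p b (n - k)).eval y

variable [CharZero K]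

/-! ## Proposition 1: the expansion `e^{λF} f = Σ λᵏ Fᵏ f/k!` and polynomiality in `λ` -/

section Generator

variable {F : PowerSeries K}

/-- **`e^{aF} f = Σ_{k<N} aᵏ/k! · F(D)^k f`** (`N > deg f`; the series `exp (aF)` expanded in powers
of the generator, a finite sum on each polynomial). [cite: RotaKahanerOdlyzko1973, §8 (proof of
Proposition 1: "`P^{−λ} = p (D)^λ`"), p. 714] -/
theorem expOp_apply_eq_sum (hF : PowerSeries.constantCoeff F = 0) (a : K) (f : K[X]) {N : ℕ}
    (hN : f.natDegree < N) :
    expOp F a f = ∑ k ∈ range N, (a ^ k / (k.factorial : K)) • (diffOp F ^ k) f := by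
  rw [expOp_eq, diffOp_subst hF _ f hN]
  refine sum_congr rfl fun k _ => ?_
  rw [PowerSeries.coeff_rescale, PowerSeries.coeff_exp, map_div₀, map_one, map_natCast, mul_one_div]

/-- **Proposition 1 (coefficients)**: for fixed `f`, every coefficient of `e^{λF} f` is a polynomial in
`λ` of degree at most `deg f` — hence the coefficients `c(n,k,λ)` of `p_n^{[λ]} = e^{∓λF} p_n` are
polynomials of degree at most `n` in `λ`. [cite: RotaKahanerOdlyzko1973, §8 Proposition 1, pp. 713–714] -/
theorem exists_polynomial_coeff_expOp (hF : PowerSeries.constantCoeff F = 0) (f : K[X]) :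
    ∃ c : ℕ → K[X], (∀ m, (c m).natDegree ≤ f.natDegree) ∧
      ∀ (a : K) (m : ℕ), (expOp F a f).coeff m = (c m).eval a := by
  refine ⟨fun m => ∑ k ∈ range (f.natDegree + 1),
    C (((diffOp F ^ k) f).coeff m / (k.factorial : K)) * X ^ k, fun m => ?_, fun a m => ?_⟩
  · exact natDegree_sum_le_of_forall_le _ _ fun k hk =>
      (natDegree_C_mul_X_pow_le _ _).trans (Nat.lt_succ_iff.1 (mem_range.1 hk))
  · rw [expOp_apply_eq_sum hF a f (lt_add_one _), finsetSum_coeff, eval_finsetSum]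
    refine sum_congr rfl fun k _ => ?_
    rw [coeff_smul, smul_eq_mul, eval_mul, eval_C, eval_pow, eval_X]
    ring

/-- **Proposition 1 (values)**: for fixed `f` and `x`, `λ ↦ (e^{λF} f)(x)` is a polynomial in `λ` of
degree at most `deg f` (so `p_n^{[λ]} (a)` is a polynomial in `λ` — the substitution `λ = x − n` of
Proposition 4 makes sense). [cite: RotaKahanerOdlyzko1973, §8 Proposition 1, pp. 713–714] -/
theorem exists_polynomial_eval_expOp (hF : PowerSeries.constantCoeff F = 0) (f : K[X]) (x : K) :
    ∃ c : K[X], c.natDegree ≤ f.natDegree ∧ ∀ a : K, (expOp F a f).eval x = c.eval a := by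
  refine ⟨∑ k ∈ range (f.natDegree + 1), C (((diffOp F ^ k) f).eval x / (k.factorial : K)) * X ^ k,
    ?_, fun a => ?_⟩
  · exact natDegree_sum_le_of_forall_le _ _ fun k hk =>
      (natDegree_C_mul_X_pow_le _ _).trans (Nat.lt_succ_iff.1 (mem_range.1 hk))
  · rw [expOp_apply_eq_sum hF a f (lt_add_one _), eval_finsetSum, eval_finsetSum]
    refine sum_congr rfl fun k _ => ?_
    rw [eval_smul, smul_eq_mul, eval_mul, eval_C, eval_pow, eval_X]
    ring

end Generator

/-! ## Proposition 2: characterizations of Steffensen sequences -/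

namespace IsSteffensenSequence

variable {p s : K → ℕ → K[X]}

omit [CharZero K] in
/-- `deg s_n^{[a]} = n` as a `natDegree`. [cite: RotaKahanerOdlyzko1973, §8, p. 714] -/
theorem natDegree_eq (hs : IsSteffensenSequence p s) (a : K) (n : ℕ) : (s a n).natDegree = n :=
  natDegree_eq_of_degree_eq_some (hs.degree_eq a n)

/-- **Proposition 2, (c) ⇒ (a)**: `s_n^{[λ]} = T⁻¹ p_n^{[λ]}` (here `S = T⁻¹`, an invertible
shift-invariant operator) is a Steffensen sequence relative to the cross-sequence `p_n^{[λ]}`.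
[cite: RotaKahanerOdlyzko1973, §8 Proposition 2 (c) ⇒ (a), p. 714] -/
theorem of_map (hp : IsCrossSequence p) {S : K[X] →ₗ[K] K[X]} (hS : IsShiftInvariant S) (hS1 : S 1 ≠ 0) :
    IsSteffensenSequence p fun a n => S (p a n) where
  degree_eq a n := by
    obtain ⟨ψ, rfl⟩ := isShiftInvariant_iff_exists_eq_diffOp.1 hS
    have hψ : PowerSeries.constantCoeff ψ ≠ 0 := fun h => hS1 (by rw [diffOp_apply_one, h, C_0])
    rw [degree_diffOp_eq hψ, hp.degree_eq]
  eval_add a b n x y := by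
    -- (*) as a polynomial identity in `x`, hit with `S`
    have h0 : taylor y (p (a + b) n) = ∑ k ∈ range (n + 1), ((n.choose k : K) * (p b (n - k)).eval y) • p a k := by
      apply Polynomial.funext
      intro z
      rw [taylor_eval, hp.eval_add a b n z y, eval_finsetSum]
      exact sum_congr rfl fun k _ => by rw [eval_smul, smul_eq_mul]; ring
    have h := congrArg S h0
    rw [hS.apply_taylor, map_sum] at h
    have h' := congrArg (eval x) h
    rw [taylor_eval, eval_finsetSum] at h'
    rw [h']
    exact sum_congr rfl fun k _ => by rw [map_smul, eval_smul, smul_eq_mul]; ring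

/-- **Each `s_n^{[λ]}` of a Steffensen sequence is a Sheffer set for the delta operator `Q` of
`p_n = p_n^{[0]}`** (`μ = 0` in the defining identity is the binomial identity (S)).
[cite: RotaKahanerOdlyzko1973, §8 Proposition 2, p. 714] -/
theorem isShefferSequence (hp : IsCrossSequence p) (hs : IsSteffensenSequence p s) (a : K) :
    IsShefferSequence (loweringOperator hp.isBinomialType_zero.degree_eq) (s a) := by
  refine (isShefferSequence_iff_eval_add hp.isBinomialType_zero.isDeltaOperator_loweringOperator
    hp.isBinomialType_zero.isBasicSequence).2 ⟨hs.degree_eq a, fun n x y => ?_⟩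
  have h := hs.eval_add a 0 n y x
  rw [add_zero, add_comm y x] at h
  rw [h, ← sum_range_reflect]
  refine sum_congr rfl fun k hk => ?_
  have hkn : k ≤ n := Nat.lt_succ_iff.1 (mem_range.1 hk)
  rw [Nat.add_sub_cancel, Nat.sub_sub_self hkn, Nat.choose_symm hkn]
  ring

/-- The defining identity at `y ↦ 0`: `s_n^{[λ+μ]} = Σ_k C(n,k) p_{n−k}^{[μ]} (0) · s_k^{[λ]}`.
[cite: RotaKahanerOdlyzko1973, §8 Proposition 2, p. 714] -/
theorem apply_add_eq_sum (hs : IsSteffensenSequence p s) (a b : K) (n : ℕ) :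
    s (a + b) n = ∑ k ∈ range (n + 1), ((n.choose k : K) * (p b (n - k)).eval 0) • s a k := by
  apply Polynomial.funext
  intro x
  rw [← add_zero x, hs.eval_add a b n x 0, add_zero, eval_finsetSum]
  exact sum_congr rfl fun k _ => by rw [eval_smul, smul_eq_mul]; ring

/-- A linear operator carrying `p_n^{[0]}` to `s_n^{[a]}` carries `p_n^{[b]}` to `s_n^{[a+b]}`.
[cite: RotaKahanerOdlyzko1973, §8 Proposition 2, p. 714] -/
theorem map_apply_of_map_zero (hp : IsCrossSequence p) (hs : IsSteffensenSequence p s)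
    {T : K[X] →ₗ[K] K[X]} {a : K} (hT : ∀ n, T (p 0 n) = s a n) (b : K) (n : ℕ) :
    T (p b n) = s (a + b) n := by
  have h0 := hp.apply_add_eq_sum 0 b n
  rw [zero_add] at h0
  rw [h0, map_sum, hs.apply_add_eq_sum a b n]
  exact sum_congr rfl fun k _ => by rw [map_smul, hT]

/-- **Proposition 2, (a) ⇒ (c)**: a Steffensen sequence is `s_n^{[λ]} = T⁻¹ p_n^{[λ]}` for ONE
invertible shift-invariant operator `T⁻¹` (the operator `p_n ↦ s_n^{[0]}`).
[cite: RotaKahanerOdlyzko1973, §8 Proposition 2 (a) ⇒ (c), p. 714] -/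
theorem exists_isShiftInvariant (hp : IsCrossSequence p) (hs : IsSteffensenSequence p s) :
    ∃ S : K[X] →ₗ[K] K[X], IsShiftInvariant S ∧ Function.Bijective S ∧ ∀ a n, s a n = S (p a n) := by
  obtain ⟨S, hS, hSb, hSp⟩ := (hs.isShefferSequence hp 0).exists_isShiftInvariant
    hp.isBinomialType_zero.isDeltaOperator_loweringOperator hp.isBinomialType_zero.isBasicSequence
  refine ⟨S, hS, hSb, fun a n => ?_⟩
  rw [hs.map_apply_of_map_zero hp hSp a n, zero_add]

/-- **Proposition 2, (a) ⇒ (b)**: for a Steffensen sequence there are a delta operator `Q` (that of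
`p_n`) and a one-parameter group `P^{−λ}` (that of the cross-sequence) with `Q s_n^{[λ]} = n s_{n−1}^{[λ]}`
and `P^{−λ} s_n^{[μ]} = s_n^{[λ+μ]}` (in particular `P^{−λ} s_n^{[0]} = s_n^{[λ]}`).
[cite: RotaKahanerOdlyzko1973, §8 Proposition 2 (a) ⇒ (b), p. 714] -/
theorem exists_delta_group (hp : IsCrossSequence p) (hs : IsSteffensenSequence p s) :
    ∃ (Q : K[X] →ₗ[K] K[X]) (P : K → (K[X] →ₗ[K] K[X])), IsDeltaOperator Q ∧ IsOneParameterGroup P ∧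
      (∀ (a : K) (n : ℕ), Q (s a (n + 1)) = ((n + 1 : ℕ) : K) • s a n) ∧
      ∀ (a b : K) (n : ℕ), P a (s b n) = s (a + b) n := by
  obtain ⟨P, hP, hq, hPp⟩ := hp.exists_isOneParameterGroup
  obtain ⟨S, hS, -, hSp⟩ := hs.exists_isShiftInvariant hp
  have hδ := hq.isDeltaOperator_loweringOperator
  refine ⟨loweringOperator hq.degree_eq, P, hδ, hP, fun a n => ?_, fun a b n => ?_⟩
  · rw [hSp a (n + 1), hSp a n, hPp a (n + 1), hPp a n, hδ.isShiftInvariant.comm_apply hS,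
      hδ.isShiftInvariant.comm_apply (hP.isShiftInvariant a), loweringOperator_apply_succ, map_smul, map_smul]
  · rw [hSp b n, hSp (a + b) n, (hP.isShiftInvariant a).comm_apply hS, hPp b n, hPp (a + b) n,
      ← hP.map_add_apply]

end IsSteffensenSequence

/-- **Proposition 2, (b) ⇒ (c), (a)**: if `deg s_n^{[λ]} = n`, `Q s_n^{[λ]} = n s_{n−1}^{[λ]}` for a delta
operator `Q` and `P^{−λ} s_n^{[0]} = s_n^{[λ]}` for a one-parameter group `P^{−λ}`, then `s_n^{[λ]}` is
`S p_n^{[λ]}` for the cross-sequence `p_n^{[λ]} = P^{−λ} q_n` (`q_n` basic for `Q`) and an invertible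
shift-invariant `S`, hence a Steffensen sequence.
[cite: RotaKahanerOdlyzko1973, §8 Proposition 2 (b) ⇒ (c) ⇒ (a), p. 714] -/
theorem exists_isSteffensenSequence_of_delta_group {s : K → ℕ → K[X]}
    (hdeg : ∀ (a : K) (n : ℕ), (s a n).degree = n) {Q : K[X] →ₗ[K] K[X]} (hQ : IsDeltaOperator Q)
    {P : K → (K[X] →ₗ[K] K[X])} (hP : IsOneParameterGroup P)
    (hQs : ∀ (a : K) (n : ℕ), Q (s a (n + 1)) = ((n + 1 : ℕ) : K) • s a n)
    (hPs : ∀ (a : K) (n : ℕ), P a (s 0 n) = s a n) :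
    ∃ (p : K → ℕ → K[X]) (S : K[X] →ₗ[K] K[X]), IsCrossSequence p ∧ IsShiftInvariant S ∧
      Function.Bijective S ∧ (∀ a n, s a n = S (p a n)) ∧ IsSteffensenSequence p s := by
  have hs0 : IsShefferSequence Q (s 0) := ⟨hdeg 0, hQs 0⟩
  obtain ⟨S, hS, hSb, hSq⟩ := hs0.exists_isShiftInvariant hQ hQ.isBasicSequence_basicSequence
  have hp : IsCrossSequence fun a n => P a (hQ.basicSequence n) := hP.isCrossSequence hQ.isBinomialType_basicSequence
  have hsS : ∀ a n, s a n = S (P a (hQ.basicSequence n)) := fun a n => by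
    rw [← hPs, ← hSq, (hP.isShiftInvariant a).comm_apply hS]
  have hS1 : S 1 ≠ 0 := fun h => one_ne_zero (hSb.1 (h.trans (LinearMap.map_zero S).symm))
  refine ⟨_, S, hp, hS, hSb, hsS, ?_⟩
  have h := IsSteffensenSequence.of_map hp hS hS1
  have hs_eq : s = fun a n => S (P a (hQ.basicSequence n)) := funext fun a => funext fun n => hsS a n
  rw [hs_eq]
  exact h

/-! ## Proposition 4: the difference equation in `λ` when `I − P = Q` -/

omit [CharZero K] in
/-- **Proposition 4 (the displayed computation)**: if `I − P = Q` (`P = P^{1}`, here `P (−1)`), `Q` the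
delta (lowering) operator of the binomial-type `q_n`, then the cross-sequence `p_n^{[λ]} = P^{−λ} q_n`
satisfies `p_n^{[λ+1]} − p_n^{[λ]} = P^{−λ−1} (I − P) q_n = n p_{n−1}^{[λ+1]}` — a difference equation in `λ`
of Sheffer type for `Δ`. [cite: RotaKahanerOdlyzko1973, §8 Proposition 4 (proof), p. 715] -/
theorem IsOneParameterGroup.apply_add_one_sub {P : K → (K[X] →ₗ[K] K[X])} (hP : IsOneParameterGroup P)
    {q : ℕ → K[X]} (hq : IsBinomialType q)
    (hIP : LinearMap.id - P (-1) = loweringOperator hq.degree_eq) (a : K) (n : ℕ) :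
    P (a + 1) (q (n + 1)) - P a (q (n + 1)) = ((n + 1 : ℕ) : K) • P (a + 1) (q n) := by
  have h : P a = P (a + 1) ∘ₗ P (-1) := by rw [← hP.map_add, add_neg_cancel_right]
  rw [h, LinearMap.comp_apply, ← map_sub, ← LinearMap.map_smul, ← loweringOperator_apply_succ hq.degree_eq,
    ← hIP, LinearMap.sub_apply, LinearMap.id_apply]

omit [CharZero K] in
/-- The same for a Steffensen-type twist `S p_n^{[λ]}` (`S` shift-invariant): the difference equation is
inherited. [cite: RotaKahanerOdlyzko1973, §8 Proposition 4 ("for a Steffensen sequence `p_n^{[λ]}`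
relative to `Q`"), p. 715] -/
theorem IsOneParameterGroup.map_apply_add_one_sub {P : K → (K[X] →ₗ[K] K[X])} (hP : IsOneParameterGroup P)
    {q : ℕ → K[X]} (hq : IsBinomialType q)
    (hIP : LinearMap.id - P (-1) = loweringOperator hq.degree_eq) (S : K[X] →ₗ[K] K[X]) (a : K) (n : ℕ) :
    S (P (a + 1) (q (n + 1))) - S (P a (q (n + 1))) = ((n + 1 : ℕ) : K) • S (P (a + 1) (q n)) := by
  rw [← map_sub, hP.apply_add_one_sub hq hIP, map_smul]

/-! ## Proposition 5: Appell cross-sequences compose additively under umbral composition -/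

/-- **Proposition 5**: for an Appell cross-sequence `p_n^{[λ]} = P^{−λ} xⁿ`,
`p^{[λ]} (p^{[μ]} (x)) = p^{[λ+μ]} (x)` (Corollary 2 to Theorem 7; the tree's `umbralComp s t n = s_n (t (x))`).
[cite: RotaKahanerOdlyzko1973, §8 Proposition 5, p. 715] [cite: RotaKahanerOdlyzko1973, §7 Corollary 2, p. 709] -/
theorem umbralComp_oneParameterGroup_X_pow {P : K → (K[X] →ₗ[K] K[X])} (hP : IsOneParameterGroup P) (a b : K) :
    umbralComp (fun n => P a (X ^ n)) (fun n => P b (X ^ n)) = fun n => P (a + b) (X ^ n) := by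
  obtain ⟨σ, hσ⟩ := isShiftInvariant_iff_exists_eq_diffOp.1 (hP.isShiftInvariant a)
  obtain ⟨τ, hτ⟩ := isShiftInvariant_iff_exists_eq_diffOp.1 (hP.isShiftInvariant b)
  funext n
  rw [umbralComp_appell_eq_diffOp σ τ (s := fun n => P a (X ^ n)) (t := fun n => P b (X ^ n))
      (fun n => by rw [hσ]) (fun n => by rw [hτ]) n,
    diffOp_mul, ← hσ, ← hτ, add_comm, hP.map_add_apply, LinearMap.comp_apply]

/-- Proposition 5 for the generator form: `e^{aF} xⁿ ∘ e^{bF} xⁿ = e^{(a+b)F} xⁿ` umbrally.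
[cite: RotaKahanerOdlyzko1973, §8 Proposition 5, p. 715] -/
theorem umbralComp_expOp_X_pow {F : PowerSeries K} (hF : PowerSeries.constantCoeff F = 0) (a b : K) :
    umbralComp (fun n => expOp F a (X ^ n)) (fun n => expOp F b (X ^ n)) = fun n => expOp F (a + b) (X ^ n) :=
  umbralComp_oneParameterGroup_X_pow (isOneParameterGroup_expOp hF) a b

/-! ## Proposition 3: the binomial-type sequence `x s_{n−1}^{[n]} (x)` -/

section Prop3

variable {φ F : PowerSeries K}

/-- `e^{aF}(D)` commutes with `D`. [cite: RotaKahanerOdlyzko1973, §8 Proposition 3 (proof), pp. 714–715] -/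
theorem expOp_derivative_comm (F : PowerSeries K) (a : K) :
    expOp F a ∘ₗ derivative = derivative ∘ₗ expOp F a :=
  (isShiftInvariant_expOp F a).comp_comm isShiftInvariant_derivative

/-- **`R = PQ` in closed form**: `e^{aF}(D) ∘ (D φ(D)) = D ∘ (e^{aF} φ)(D)`.
[cite: RotaKahanerOdlyzko1973, §8 Proposition 3 (proof: "basic with delta operator `R = PQ`"),
pp. 714–715] -/
theorem expOp_comp_derivative_comp_diffOp (F : PowerSeries K) (a : K) (φ : PowerSeries K) :
    expOp F a ∘ₗ (derivative ∘ₗ diffOp φ) =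
      derivative ∘ₗ diffOp ((PowerSeries.rescale a (PowerSeries.exp K)).subst F * φ) := by
  rw [← LinearMap.comp_assoc, expOp_derivative_comm, LinearMap.comp_assoc, expOp_eq, ← diffOp_mul]

/-- `(e^{−F} φ)⁻¹ = e^{F} φ⁻¹`. [cite: RotaKahanerOdlyzko1973, §8 Proposition 3 (proof), pp. 714–715] -/
theorem rescale_neg_one_exp_subst_mul_inv (hF : PowerSeries.constantCoeff F = 0) (φ : PowerSeries K) :
    ((PowerSeries.rescale (-1 : K) (PowerSeries.exp K)).subst F * φ : PowerSeries K)⁻¹ =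
      (PowerSeries.rescale (1 : K) (PowerSeries.exp K)).subst F * φ⁻¹ := by
  have hE : ((PowerSeries.rescale (-1 : K) (PowerSeries.exp K)).subst F : PowerSeries K)⁻¹ =
      (PowerSeries.rescale (1 : K) (PowerSeries.exp K)).subst F := by
    rw [PowerSeries.inv_eq_iff_mul_eq_one (by rw [constantCoeff_rescale_exp_subst hF]; exact one_ne_zero),
      rescale_exp_subst_mul hF, add_neg_cancel, rescale_zero_exp_subst]
  rw [PowerSeries.mul_inv_rev, hE, mul_comm]

/-- `(e^{F})ⁿ = e^{nF}`. [cite: RotaKahanerOdlyzko1973, §8 Proposition 3 (proof), pp. 714–715] -/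
theorem rescale_one_exp_subst_pow (hF : PowerSeries.constantCoeff F = 0) (n : ℕ) :
    ((PowerSeries.rescale (1 : K) (PowerSeries.exp K)).subst F : PowerSeries K) ^ n =
      (PowerSeries.rescale (n : K) (PowerSeries.exp K)).subst F := by
  rw [← PowerSeries.subst_pow (PowerSeries.HasSubst.of_constantCoeff_zero' hF), rescale_exp_pow, mul_one]

/-- **`(Q′)⁻¹ p_n = φ(D)^{−(n+1)} xⁿ`** for `Q = D φ(D)` with basic `p_n`: the Rodrigues formula
`p_{n+1} = x (Q′)⁻¹ p_n` against the transfer formula `p_{n+1} = x φ(D)^{−n−1} xⁿ`, `x` cancelled.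
[cite: RotaKahanerOdlyzko1973, §4 Theorem 4 (3)–(4), pp. 695–696] -/
theorem diffOp_inv_basicSequence_eq (hφ : PowerSeries.constantCoeff φ ≠ 0) (n : ℕ) :
    diffOp (PowerSeries.derivative K (PowerSeries.X * φ))⁻¹
        ((isDeltaOperator_derivative_comp_diffOp hφ).basicSequence n) =
      diffOp (φ⁻¹ ^ (n + 1)) (X ^ n) := by
  have h1 := basicSequence_derivative_comp_diffOp_succ hφ n
  have h2 := basicSequence_derivative_comp_diffOp_eq_X_mul hφ (Nat.succ_ne_zero n)
  rw [Nat.succ_sub_one] at h2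
  exact mul_left_cancel₀ X_ne_zero (h1.symm.trans h2)

/-- **Proposition 3**: let `Q = D φ(D)` (`φ (0) ≠ 0`) with basic polynomials `p_n`, `e^{aF}` an
exponential one-parameter group, and `s_n^{[a]} = (Q′)⁻¹ e^{aF} p_n` the Steffensen sequence relative to
`T = Q′`. Then `r_0 = 1`, `r_n = x s_{n−1}^{[n]} (x)` (`n ≥ 1`) is the basic sequence of the delta operator
`R = PQ = e^{−F} Q` — in particular a sequence of binomial type.
[cite: RotaKahanerOdlyzko1973, §8 Proposition 3, pp. 714–715] -/
theorem isBasicSequence_X_mul_steffensen (hφ : PowerSeries.constantCoeff φ ≠ 0)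
    (hF : PowerSeries.constantCoeff F = 0) :
    IsBasicSequence (expOp F (-1) ∘ₗ (derivative ∘ₗ diffOp φ)) fun n =>
      Nat.casesOn n 1 fun m => X * diffOp (PowerSeries.derivative K (PowerSeries.X * φ))⁻¹
        (expOp F ((m + 1 : ℕ) : K) ((isDeltaOperator_derivative_comp_diffOp hφ).basicSequence m)) := by
  -- `R = e^{−F} Q = D ∘ (e^{−F} φ)(D)`
  set ψ : PowerSeries K := (PowerSeries.rescale (-1 : K) (PowerSeries.exp K)).subst F * φ with hψdef
  have hψ : PowerSeries.constantCoeff ψ ≠ 0 := by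
    rw [hψdef, map_mul, constantCoeff_rescale_exp_subst hF, one_mul]
    exact hφ
  have hR : expOp F (-1) ∘ₗ (derivative ∘ₗ diffOp φ) = derivative ∘ₗ diffOp ψ :=
    expOp_comp_derivative_comp_diffOp F (-1) φ
  rw [hR]
  -- compare with the transfer formula for `R`
  have hb := (isDeltaOperator_derivative_comp_diffOp hψ).isBasicSequence_basicSequence
  suffices h : (fun n => Nat.casesOn n 1 fun m => X * diffOp (PowerSeries.derivative K (PowerSeries.X * φ))⁻¹
      (expOp F ((m + 1 : ℕ) : K) ((isDeltaOperator_derivative_comp_diffOp hφ).basicSequence m)) : ℕ → K[X]) =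
      (isDeltaOperator_derivative_comp_diffOp hψ).basicSequence by
    rw [h]
    exact hb
  funext n
  cases n with
  | zero => exact hb.apply_zero.symm
  | succ m =>
    show X * diffOp (PowerSeries.derivative K (PowerSeries.X * φ))⁻¹
        (expOp F ((m + 1 : ℕ) : K) ((isDeltaOperator_derivative_comp_diffOp hφ).basicSequence m)) =
      (isDeltaOperator_derivative_comp_diffOp hψ).basicSequence (m + 1)
    rw [basicSequence_derivative_comp_diffOp_eq_X_mul hψ (Nat.succ_ne_zero m), Nat.succ_sub_one, hψdef,
      rescale_neg_one_exp_subst_mul_inv hF φ, mul_pow, rescale_one_exp_subst_pow hF, diffOp_mul,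
      LinearMap.comp_apply, ← diffOp_inv_basicSequence_eq hφ m, ← expOp_eq,
      (isShiftInvariant_expOp F _).comm_apply (isShiftInvariant_diffOp _)]

/-- Proposition 3, the binomial-type conclusion. [cite: RotaKahanerOdlyzko1973, §8 Proposition 3,
pp. 714–715] -/
theorem isBinomialType_X_mul_steffensen (hφ : PowerSeries.constantCoeff φ ≠ 0)
    (hF : PowerSeries.constantCoeff F = 0) :
    IsBinomialType fun n =>
      Nat.casesOn n 1 fun m => X * diffOp (PowerSeries.derivative K (PowerSeries.X * φ))⁻¹
        (expOp F ((m + 1 : ℕ) : K) ((isDeltaOperator_derivative_comp_diffOp hφ).basicSequence m)) :=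
  (isBasicSequence_X_mul_steffensen hφ hF).isBinomialType
    ((isDeltaOperator_derivative_comp_diffOp hφ).isShiftInvariant_comp (isShiftInvariant_expOp F (-1))
      (by rw [expOp_apply_one hF]; exact one_ne_zero))

/-- **The Abel instance** (`Q = D`, `φ = 1`, `F = t`, `e^{aF} = E^a`): `s_n^{[a]} = (x + a)ⁿ` and
`x s_{n−1}^{[n]} (x) = x (x + n)^{n−1}`, the Abel polynomials for `E⁻¹ D` — the tree's
`abelPolynomial (−1)`. [cite: RotaKahanerOdlyzko1973, §8 Proposition 3, pp. 714–715] -/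
theorem abelPolynomial_neg_one_eq (n : ℕ) :
    abelPolynomial (-1 : K) (n + 1) = X * expOp (PowerSeries.X : PowerSeries K) ((n + 1 : ℕ) : K) (X ^ n) := by
  rw [abelPolynomial_succ, expOp_X, taylor_pow, taylor_X, mul_neg_one, map_neg, sub_neg_eq_add]

end Prop3

end Literature.Algebra.Polynomial
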